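import Mathlib
import HarnessLib
import Summits.ValiantsHypothesis.ValiantsHypothesis.Theorems.LacunarySymmetroidMatrixDescartesProductPlusOneLetterVariance

/-!
# ValiantsHypothesis / LacunarySymmetroid — crux `MatrixDescartes` (stmt-ValiantsHypothesis-18050, V1),
# LINE (A) «product_plus_one», floor (every coupling): the type-β window counts are SIGN-FREE

val-idea-25 g3's AB6-2 (HOME/STATUS 2026-08-29 00:26:16Z, memo §12; crit-1 g4 #150 on the every-K hypothesis shape): the eight «at most one
zero on a type-β window» counts of ✓ `…ABWindow` (K = 3, bottom coupling), ✓ `…ABWindowMiddle` (K = 3, middle), ✓ `…ABWindowTop` (K = 3,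
top) and ✓ `…ABWindowK` (every K, bottom) hold for EVERY company: the row-sign hypotheses `hus` (upper-signed), `hnd` (no-dip), `hls`
(lower-signed) are DROPPED, every other binder and the conclusion are verbatim.  Each is an instance of ✓
`eulerNumerator_roots_Icc_le_one_of_reducedMoment_neg` (`…LetterVariance`): at a zero the first letter moment vanishes, and the reduced
second moment `Σ_l e_l(e_l − κ)·t^{d_l}·A_l(t)` with `κ` = the `e` of a second letter keeps ONE letter at K = 3 (bottom `κ = q`:
`−p(q−p)t^pA₁`, `κ = p`: `q(q−p)t^qA₂`; middle `κ = −p`: `s(p+s)t^sA₂`, `κ = s`: `p(p+s)t^{−p}A₀`; top `κ = −q`: `−p(q−p)t^{p−q}B₁`,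
`κ = p−q`: `pq·t^{−q}B₀`), and at every K (bottom) `κ = e_{K−1}` resp. `κ = e_1` leaves one-signed terms, strict at letter `1` resp. `2`.
The sign hypotheses remain needed only for the letter-sum MONOTONICITY that LOCATES the windows (✓ `antitoneOn_letterSum` etc.), not
for the count.

* §1–§3 (K = 3; bottom / middle / top): `eval_row_three(_middle)`, `letterSum_three(_middle/_top)_eq_div`, `reducedMoment_three_*`, and the
  ★ `…_signfree` twins (names = the originals with the suffix `_signfree`);
* §4 (every K, bottom): `letterSumK_eq_inv_mul`, ★ `eulerNumeratorK_roots_Icc_le_one_of_letterSums_pos_signfree` / `…_neg_signfree`.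
The order hypotheses (`hp`, `hpq`, `hs`, `hK`, `hd`) are kept binder-for-binder with the originals (drop-in twins), even where a twin uses less.

HONEST FRAMING: located counting lemmas (type-β windows only; the type-α windows — riser budget AB4 — are untouched); NOT
`OneChangeFloorK3`, not `stub_classRowK3`, not `stub_eulerBoundK3`, not `stub_polyLaw`, not `MatrixDescartes`, not Conjecture B;
`VP ≠ VNP` is NOT proved.  No definitions, no named facts; Mathlib + ✓ `…LetterVariance` only.
-/

set_option linter.dupNamespace false

namespace Summit.ValiantsHypothesis.ValiantsHypothesis.Theorems.LacunarySymmetroidMatrixDescartes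

namespace ProductPlusOne

open Polynomial Finset
open scoped BigOperators

/-! ### §1 K = 3, bottom coupling — sign-free twins of ✓ `…ABWindow` -/

/-- Row factorisation at K = 3, support `(d₀, d₀+p, d₀+q)`: `f(t) = t^{d₀}·(b₀ + b₁ t^p + b₂ t^q)`. [folklore] -/
theorem eval_row_three (d0 p q : ℕ) (b : Fin 3 → ℝ) (t : ℝ) :
    (∑ l, C (b l) * X ^ ((![d0, d0 + p, d0 + q] : Fin 3 → ℕ) l) : ℝ[X]).eval t = t ^ d0 * (b 0 + b 1 * t ^ p + b 2 * t ^ q) := by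
  rw [(eval_trinomial_three d0 p q b t).1]; ring

/-- One letter sum through the reduced rows `g_j = a_{j0} + a_{j1}t^p + a_{j2}t^q`: `Σ_j a_{jl}/f_j(t) = (Σ_j a_{jl}/g_j(t))/t^{d₀}`. [folklore] -/
theorem letterSum_three_eq_div (d0 p q : ℕ) {m : ℕ} (a : Fin m → Fin 3 → ℝ) (l : Fin 3) (t : ℝ) :
    ∑ j, a j l / (∑ l', C (a j l') * X ^ ((![d0, d0 + p, d0 + q] : Fin 3 → ℕ) l') : ℝ[X]).eval t
      = (∑ j, a j l / (a j 0 + a j 1 * t ^ p + a j 2 * t ^ q)) / t ^ d0 := by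
  rw [Finset.sum_div]
  refine Finset.sum_congr rfl fun j _ => ?_
  rw [eval_row_three, mul_comm, div_div]

/-- The three reduced second moments at K = 3, support `(d₀, d₀+p, d₀+q)`, ANY coupling `l₀`, with `κ` chosen at a second letter `l₁`:
only the third letter survives.  Bottom coupling (`l₀ = 0`): `κ = q` ↦ `−p(q−p)·t^p·A₁`, `κ = p` ↦ `q(q−p)·t^q·A₂`. [folklore] -/
theorem reducedMoment_three_bottom (d0 p q : ℕ) {m : ℕ} (a : Fin m → Fin 3 → ℝ) {t : ℝ} (ht : t ≠ 0) :
    (∑ l, ((((![d0, d0 + p, d0 + q] : Fin 3 → ℕ) l : ℕ) : ℝ) - (((![d0, d0 + p, d0 + q] : Fin 3 → ℕ) 0 : ℕ) : ℝ))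
        * (((((![d0, d0 + p, d0 + q] : Fin 3 → ℕ) l : ℕ) : ℝ) - (((![d0, d0 + p, d0 + q] : Fin 3 → ℕ) 0 : ℕ) : ℝ)) - (q : ℝ))
        * t ^ ((![d0, d0 + p, d0 + q] : Fin 3 → ℕ) l)
        * ∑ j, a j l / (∑ l', C (a j l') * X ^ ((![d0, d0 + p, d0 + q] : Fin 3 → ℕ) l') : ℝ[X]).eval t
      = -((p : ℝ) * ((q : ℝ) - p) * t ^ p) * ∑ j, a j 1 / (a j 0 + a j 1 * t ^ p + a j 2 * t ^ q)) ∧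
    (∑ l, ((((![d0, d0 + p, d0 + q] : Fin 3 → ℕ) l : ℕ) : ℝ) - (((![d0, d0 + p, d0 + q] : Fin 3 → ℕ) 0 : ℕ) : ℝ))
        * (((((![d0, d0 + p, d0 + q] : Fin 3 → ℕ) l : ℕ) : ℝ) - (((![d0, d0 + p, d0 + q] : Fin 3 → ℕ) 0 : ℕ) : ℝ)) - (p : ℝ))
        * t ^ ((![d0, d0 + p, d0 + q] : Fin 3 → ℕ) l)
        * ∑ j, a j l / (∑ l', C (a j l') * X ^ ((![d0, d0 + p, d0 + q] : Fin 3 → ℕ) l') : ℝ[X]).eval t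
      = ((q : ℝ) * ((q : ℝ) - p) * t ^ q) * ∑ j, a j 2 / (a j 0 + a j 1 * t ^ p + a j 2 * t ^ q)) := by
  have htd : t ^ d0 ≠ 0 := pow_ne_zero _ ht
  constructor <;>
  · simp only [letterSum_three_eq_div]
    simp only [Fin.sum_univ_three, Matrix.cons_val_zero, Matrix.cons_val_one, Matrix.cons_val_two, Matrix.head_cons,
      Matrix.tail_cons, Nat.cast_add]
    field_simp
    ring

/-- ★ **Sign-free twin of ✓ `eulerNumerator_roots_Icc_le_one_of_letterSum_one_pos`** (K = 3, bottom coupling, `0 < p < q`, EVERY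
company — the upper-signed hypothesis `hus` is dropped, all other binders verbatim): on a pole-free `[u,v] ⊂ (0,∞)` on which
`A₁ = Σ_j a_{j1}/g_j > 0` the c-free Euler numerator has AT MOST ONE zero (reduced moment `−p(q−p)·t^p·A₁(t) < 0` at every zero).
[this file's theorem; val-idea-25 AB6-2] -/
theorem eulerNumerator_roots_Icc_le_one_of_letterSum_one_pos_signfree {m : ℕ} (d0 p q : ℕ) (hp : 0 < p) (hpq : p < q)
    (a : Fin m → Fin 3 → ℝ) {u v : ℝ} (hu : 0 < u)
    (hg : ∀ x ∈ Set.Icc u v, ∀ j, a j 0 + a j 1 * x ^ p + a j 2 * x ^ q ≠ 0)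
    (hA : ∀ x ∈ Set.Icc u v, 0 < ∑ j, a j 1 / (a j 0 + a j 1 * x ^ p + a j 2 * x ^ q)) :
    ((∑ j, (∑ l, C (a j l * (((![d0, d0 + p, d0 + q] : Fin 3 → ℕ) l : ℝ) - (![d0, d0 + p, d0 + q] : Fin 3 → ℕ) 0)) *
        X ^ ((![d0, d0 + p, d0 + q] : Fin 3 → ℕ) l)) *
      ∏ i ∈ Finset.univ.erase j, (∑ l, C (a i l) * X ^ ((![d0, d0 + p, d0 + q] : Fin 3 → ℕ) l)) : ℝ[X]).roots.toFinset.filter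
        (fun t => u ≤ t ∧ t ≤ v)).card ≤ 1 := by
  have hf : ∀ t ∈ Set.Icc u v, ∀ j, (∑ l, C (a j l) * X ^ ((![d0, d0 + p, d0 + q] : Fin 3 → ℕ) l) : ℝ[X]).eval t ≠ 0 :=
    fun t ht j => by
      rw [eval_row_three]
      exact mul_ne_zero (pow_ne_zero _ (hu.trans_le ht.1).ne') (hg t ht j)
  refine eulerNumerator_roots_Icc_le_one_of_reducedMoment_neg _ a 0 hu hf fun t ht _ => ⟨(q : ℝ), ?_⟩
  have ht0 : 0 < t := hu.trans_le ht.1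
  refine ((reducedMoment_three_bottom d0 p q a ht0.ne').1).trans_lt ?_
  have h1 : 0 < (p : ℝ) * ((q : ℝ) - p) * t ^ p :=
    mul_pos (mul_pos (by exact_mod_cast hp) (sub_pos.mpr (by exact_mod_cast hpq))) (pow_pos ht0 _)
  exact mul_neg_of_neg_of_pos (neg_lt_zero.mpr h1) (hA t ht)

/-- ★ **Sign-free twin of ✓ `eulerNumerator_roots_Icc_le_one_of_letterSum_two_neg`** (K = 3, bottom coupling, `0 < p < q`, EVERY
company): on a pole-free `[u,v] ⊂ (0,∞)` on which `A₂ = Σ_j a_{j2}/g_j < 0` the c-free Euler numerator has AT MOST ONE zero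
(reduced moment `q(q−p)·t^q·A₂(t) < 0`). [this file's theorem; val-idea-25 AB6-2] -/
theorem eulerNumerator_roots_Icc_le_one_of_letterSum_two_neg_signfree {m : ℕ} (d0 p q : ℕ) (hp : 0 < p) (hpq : p < q)
    (a : Fin m → Fin 3 → ℝ) {u v : ℝ} (hu : 0 < u)
    (hg : ∀ x ∈ Set.Icc u v, ∀ j, a j 0 + a j 1 * x ^ p + a j 2 * x ^ q ≠ 0)
    (hA : ∀ x ∈ Set.Icc u v, ∑ j, a j 2 / (a j 0 + a j 1 * x ^ p + a j 2 * x ^ q) < 0) :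
    ((∑ j, (∑ l, C (a j l * (((![d0, d0 + p, d0 + q] : Fin 3 → ℕ) l : ℝ) - (![d0, d0 + p, d0 + q] : Fin 3 → ℕ) 0)) *
        X ^ ((![d0, d0 + p, d0 + q] : Fin 3 → ℕ) l)) *
      ∏ i ∈ Finset.univ.erase j, (∑ l, C (a i l) * X ^ ((![d0, d0 + p, d0 + q] : Fin 3 → ℕ) l)) : ℝ[X]).roots.toFinset.filter
        (fun t => u ≤ t ∧ t ≤ v)).card ≤ 1 := by
  have hf : ∀ t ∈ Set.Icc u v, ∀ j, (∑ l, C (a j l) * X ^ ((![d0, d0 + p, d0 + q] : Fin 3 → ℕ) l) : ℝ[X]).eval t ≠ 0 :=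
    fun t ht j => by
      rw [eval_row_three]
      exact mul_ne_zero (pow_ne_zero _ (hu.trans_le ht.1).ne') (hg t ht j)
  refine eulerNumerator_roots_Icc_le_one_of_reducedMoment_neg _ a 0 hu hf fun t ht _ => ⟨(p : ℝ), ?_⟩
  have ht0 : 0 < t := hu.trans_le ht.1
  refine ((reducedMoment_three_bottom d0 p q a ht0.ne').2).trans_lt ?_
  have h1 : 0 < (q : ℝ) * ((q : ℝ) - p) * t ^ q :=
    mul_pos (mul_pos (by exact_mod_cast (hp.trans hpq)) (sub_pos.mpr (by exact_mod_cast hpq))) (pow_pos ht0 _)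
  exact mul_neg_of_pos_of_neg h1 (hA t ht)

/-! ### §2 K = 3, middle coupling — sign-free twins of ✓ `…ABWindowMiddle` -/

/-- Row factorisation at K = 3, support `(d₀, d₀+p, d₀+p+s)`: `f(t) = t^{d₀}·(b₀ + b₁ t^p + b₂ t^{p+s})`. [folklore] -/
theorem eval_row_three_middle (d0 p s : ℕ) (b : Fin 3 → ℝ) (t : ℝ) :
    (∑ l, C (b l) * X ^ ((![d0, d0 + p, d0 + p + s] : Fin 3 → ℕ) l) : ℝ[X]).eval t
      = t ^ d0 * (b 0 + b 1 * t ^ p + b 2 * t ^ (p + s)) := by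
  rw [eval_fewnomial]
  simp only [Fin.sum_univ_three, Matrix.cons_val_zero, Matrix.cons_val_one, Matrix.cons_val_two, Matrix.head_cons,
    Matrix.tail_cons]
  ring

/-- One letter sum through the middle file's `x^p`-weighted sums: `Σ_j a_{jl}/f_j(t) = (Σ_j a_{jl}t^p/g_j(t))/t^{d₀+p}` (`t ≠ 0`). [folklore] -/
theorem letterSum_three_middle_eq_div (d0 p s : ℕ) {m : ℕ} (a : Fin m → Fin 3 → ℝ) (l : Fin 3) {t : ℝ} (ht : t ≠ 0) :
    ∑ j, a j l / (∑ l', C (a j l') * X ^ ((![d0, d0 + p, d0 + p + s] : Fin 3 → ℕ) l') : ℝ[X]).eval t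
      = (∑ j, a j l * t ^ p / (a j 0 + a j 1 * t ^ p + a j 2 * t ^ (p + s))) / t ^ (d0 + p) := by
  rw [Finset.sum_div]
  refine Finset.sum_congr rfl fun j _ => ?_
  rw [eval_row_three_middle, div_div,
    show (a j 0 + a j 1 * t ^ p + a j 2 * t ^ (p + s)) * t ^ (d0 + p) = t ^ d0 * (a j 0 + a j 1 * t ^ p + a j 2 * t ^ (p + s)) * t ^ p
      by ring,
    mul_div_mul_right _ _ (pow_ne_zero _ ht)]

/-- The two reduced second moments at the MIDDLE coupling (`l₀ = 1`, `e = (−p, 0, s)`): `κ = −p` ↦ `s(p+s)·t^s·A₂`,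
`κ = s` ↦ `p(p+s)·t^{−p}·A₀` (`A_l = Σ_j a_{jl}t^p/g_j`, the middle file's letter sums). [folklore] -/
theorem reducedMoment_three_middle (d0 p s : ℕ) {m : ℕ} (a : Fin m → Fin 3 → ℝ) {t : ℝ} (ht : t ≠ 0) :
    (∑ l, ((((![d0, d0 + p, d0 + p + s] : Fin 3 → ℕ) l : ℕ) : ℝ) - (((![d0, d0 + p, d0 + p + s] : Fin 3 → ℕ) 1 : ℕ) : ℝ))
        * (((((![d0, d0 + p, d0 + p + s] : Fin 3 → ℕ) l : ℕ) : ℝ) - (((![d0, d0 + p, d0 + p + s] : Fin 3 → ℕ) 1 : ℕ) : ℝ))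
            - (-(p : ℝ)))
        * t ^ ((![d0, d0 + p, d0 + p + s] : Fin 3 → ℕ) l)
        * ∑ j, a j l / (∑ l', C (a j l') * X ^ ((![d0, d0 + p, d0 + p + s] : Fin 3 → ℕ) l') : ℝ[X]).eval t
      = ((s : ℝ) * ((p : ℝ) + s) * t ^ s) * ∑ j, a j 2 * t ^ p / (a j 0 + a j 1 * t ^ p + a j 2 * t ^ (p + s))) ∧
    (∑ l, ((((![d0, d0 + p, d0 + p + s] : Fin 3 → ℕ) l : ℕ) : ℝ) - (((![d0, d0 + p, d0 + p + s] : Fin 3 → ℕ) 1 : ℕ) : ℝ))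
        * (((((![d0, d0 + p, d0 + p + s] : Fin 3 → ℕ) l : ℕ) : ℝ) - (((![d0, d0 + p, d0 + p + s] : Fin 3 → ℕ) 1 : ℕ) : ℝ))
            - (s : ℝ))
        * t ^ ((![d0, d0 + p, d0 + p + s] : Fin 3 → ℕ) l)
        * ∑ j, a j l / (∑ l', C (a j l') * X ^ ((![d0, d0 + p, d0 + p + s] : Fin 3 → ℕ) l') : ℝ[X]).eval t
      = ((p : ℝ) * ((p : ℝ) + s) / t ^ p) * ∑ j, a j 0 * t ^ p / (a j 0 + a j 1 * t ^ p + a j 2 * t ^ (p + s))) := by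
  constructor <;>
  · simp only [letterSum_three_middle_eq_div d0 p s a _ ht]
    simp only [Fin.sum_univ_three, Matrix.cons_val_zero, Matrix.cons_val_one, Matrix.cons_val_two, Matrix.head_cons,
      Matrix.tail_cons, Nat.cast_add]
    field_simp
    ring

/-- ★ **Sign-free twin of ✓ `eulerNumeratorMiddle_roots_Icc_le_one_of_letterSumTwo_neg`** (K = 3, MIDDLE coupling, `0 < p`, `0 < s`,
EVERY company — the no-dip hypothesis `hnd` is dropped): on a pole-free `[u,v] ⊂ (0,∞)` on which `A₂ = Σ_j a_{j2}x^p/g_j < 0`,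
`eulerNumerator d a 1` has AT MOST ONE zero (reduced moment `s(p+s)·t^s·A₂(t) < 0`). [this file's theorem; val-idea-25 AB6-2] -/
theorem eulerNumeratorMiddle_roots_Icc_le_one_of_letterSumTwo_neg_signfree {m : ℕ} (d0 p s : ℕ) (hp : 0 < p) (hs : 0 < s)
    (a : Fin m → Fin 3 → ℝ) {u v : ℝ} (hu : 0 < u)
    (hg : ∀ x ∈ Set.Icc u v, ∀ j, a j 0 + a j 1 * x ^ p + a j 2 * x ^ (p + s) ≠ 0)
    (hA : ∀ x ∈ Set.Icc u v, ∑ j, a j 2 * x ^ p / (a j 0 + a j 1 * x ^ p + a j 2 * x ^ (p + s)) < 0) :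
    ((∑ j, (∑ l, C (a j l * (((![d0, d0 + p, d0 + p + s] : Fin 3 → ℕ) l : ℝ) - (![d0, d0 + p, d0 + p + s] : Fin 3 → ℕ) 1)) *
        X ^ ((![d0, d0 + p, d0 + p + s] : Fin 3 → ℕ) l)) *
      ∏ i ∈ Finset.univ.erase j, (∑ l, C (a i l) * X ^ ((![d0, d0 + p, d0 + p + s] : Fin 3 → ℕ) l)) : ℝ[X]).roots.toFinset.filter
        (fun t => u ≤ t ∧ t ≤ v)).card ≤ 1 := by
  have hf : ∀ t ∈ Set.Icc u v, ∀ j, (∑ l, C (a j l) * X ^ ((![d0, d0 + p, d0 + p + s] : Fin 3 → ℕ) l) : ℝ[X]).eval t ≠ 0 :=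
    fun t ht j => by
      rw [eval_row_three_middle]
      exact mul_ne_zero (pow_ne_zero _ (hu.trans_le ht.1).ne') (hg t ht j)
  refine eulerNumerator_roots_Icc_le_one_of_reducedMoment_neg _ a 1 hu hf fun t ht _ => ⟨-(p : ℝ), ?_⟩
  have ht0 : 0 < t := hu.trans_le ht.1
  refine ((reducedMoment_three_middle d0 p s a ht0.ne').1).trans_lt ?_
  have h1 : 0 < (s : ℝ) * ((p : ℝ) + s) * t ^ s :=
    mul_pos (mul_pos (by exact_mod_cast hs) (by positivity)) (pow_pos ht0 _)
  exact mul_neg_of_pos_of_neg h1 (hA t ht)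

/-- ★ **Sign-free twin of ✓ `eulerNumeratorMiddle_roots_Icc_le_one_of_letterSumZero_neg`** (K = 3, MIDDLE coupling, EVERY company):
on a pole-free `[u,v] ⊂ (0,∞)` on which `A₀ = Σ_j a_{j0}x^p/g_j < 0`, `eulerNumerator d a 1` has AT MOST ONE zero
(reduced moment `p(p+s)·t^{−p}·A₀(t) < 0`). [this file's theorem; val-idea-25 AB6-2] -/
theorem eulerNumeratorMiddle_roots_Icc_le_one_of_letterSumZero_neg_signfree {m : ℕ} (d0 p s : ℕ) (hp : 0 < p) (hs : 0 < s)
    (a : Fin m → Fin 3 → ℝ) {u v : ℝ} (hu : 0 < u)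
    (hg : ∀ x ∈ Set.Icc u v, ∀ j, a j 0 + a j 1 * x ^ p + a j 2 * x ^ (p + s) ≠ 0)
    (hA : ∀ x ∈ Set.Icc u v, ∑ j, a j 0 * x ^ p / (a j 0 + a j 1 * x ^ p + a j 2 * x ^ (p + s)) < 0) :
    ((∑ j, (∑ l, C (a j l * (((![d0, d0 + p, d0 + p + s] : Fin 3 → ℕ) l : ℝ) - (![d0, d0 + p, d0 + p + s] : Fin 3 → ℕ) 1)) *
        X ^ ((![d0, d0 + p, d0 + p + s] : Fin 3 → ℕ) l)) *
      ∏ i ∈ Finset.univ.erase j, (∑ l, C (a i l) * X ^ ((![d0, d0 + p, d0 + p + s] : Fin 3 → ℕ) l)) : ℝ[X]).roots.toFinset.filter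
        (fun t => u ≤ t ∧ t ≤ v)).card ≤ 1 := by
  have hf : ∀ t ∈ Set.Icc u v, ∀ j, (∑ l, C (a j l) * X ^ ((![d0, d0 + p, d0 + p + s] : Fin 3 → ℕ) l) : ℝ[X]).eval t ≠ 0 :=
    fun t ht j => by
      rw [eval_row_three_middle]
      exact mul_ne_zero (pow_ne_zero _ (hu.trans_le ht.1).ne') (hg t ht j)
  refine eulerNumerator_roots_Icc_le_one_of_reducedMoment_neg _ a 1 hu hf fun t ht _ => ⟨(s : ℝ), ?_⟩
  have ht0 : 0 < t := hu.trans_le ht.1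
  refine ((reducedMoment_three_middle d0 p s a ht0.ne').2).trans_lt ?_
  have h1 : 0 < (p : ℝ) * ((p : ℝ) + s) / t ^ p :=
    div_pos (mul_pos (by exact_mod_cast hp) (by positivity)) (pow_pos ht0 _)
  exact mul_neg_of_pos_of_neg h1 (hA t ht)

/-! ### §3 K = 3, top coupling — sign-free twins of ✓ `…ABWindowTop` -/

/-- One letter sum through the top file's `x^q`-weighted sums: `Σ_j a_{jl}/f_j(t) = (Σ_j a_{jl}t^q/g_j(t))/t^{d₀+q}` (`t ≠ 0`). [folklore] -/
theorem letterSum_three_top_eq_div (d0 p q : ℕ) {m : ℕ} (a : Fin m → Fin 3 → ℝ) (l : Fin 3) {t : ℝ} (ht : t ≠ 0) :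
    ∑ j, a j l / (∑ l', C (a j l') * X ^ ((![d0, d0 + p, d0 + q] : Fin 3 → ℕ) l') : ℝ[X]).eval t
      = (∑ j, a j l * t ^ q / (a j 0 + a j 1 * t ^ p + a j 2 * t ^ q)) / t ^ (d0 + q) := by
  rw [Finset.sum_div]
  refine Finset.sum_congr rfl fun j _ => ?_
  rw [eval_row_three, div_div,
    show (a j 0 + a j 1 * t ^ p + a j 2 * t ^ q) * t ^ (d0 + q) = t ^ d0 * (a j 0 + a j 1 * t ^ p + a j 2 * t ^ q) * t ^ q by ring,
    mul_div_mul_right _ _ (pow_ne_zero _ ht)]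

/-- The two reduced second moments at the TOP coupling (`l₀ = 2`, `e = (−q, p−q, 0)`): `κ = −q` ↦ `−p(q−p)·t^{p−q}·B₁`,
`κ = p−q` ↦ `pq·t^{−q}·B₀` (`B_l = Σ_j a_{jl}t^q/g_j`, the top file's letter sums). [folklore] -/
theorem reducedMoment_three_top (d0 p q : ℕ) {m : ℕ} (a : Fin m → Fin 3 → ℝ) {t : ℝ} (ht : t ≠ 0) :
    (∑ l, ((((![d0, d0 + p, d0 + q] : Fin 3 → ℕ) l : ℕ) : ℝ) - (((![d0, d0 + p, d0 + q] : Fin 3 → ℕ) 2 : ℕ) : ℝ))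
        * (((((![d0, d0 + p, d0 + q] : Fin 3 → ℕ) l : ℕ) : ℝ) - (((![d0, d0 + p, d0 + q] : Fin 3 → ℕ) 2 : ℕ) : ℝ)) - (-(q : ℝ)))
        * t ^ ((![d0, d0 + p, d0 + q] : Fin 3 → ℕ) l)
        * ∑ j, a j l / (∑ l', C (a j l') * X ^ ((![d0, d0 + p, d0 + q] : Fin 3 → ℕ) l') : ℝ[X]).eval t
      = -((p : ℝ) * ((q : ℝ) - p) * t ^ p / t ^ q) * ∑ j, a j 1 * t ^ q / (a j 0 + a j 1 * t ^ p + a j 2 * t ^ q)) ∧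
    (∑ l, ((((![d0, d0 + p, d0 + q] : Fin 3 → ℕ) l : ℕ) : ℝ) - (((![d0, d0 + p, d0 + q] : Fin 3 → ℕ) 2 : ℕ) : ℝ))
        * (((((![d0, d0 + p, d0 + q] : Fin 3 → ℕ) l : ℕ) : ℝ) - (((![d0, d0 + p, d0 + q] : Fin 3 → ℕ) 2 : ℕ) : ℝ))
            - ((p : ℝ) - q))
        * t ^ ((![d0, d0 + p, d0 + q] : Fin 3 → ℕ) l)
        * ∑ j, a j l / (∑ l', C (a j l') * X ^ ((![d0, d0 + p, d0 + q] : Fin 3 → ℕ) l') : ℝ[X]).eval t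
      = ((p : ℝ) * (q : ℝ) / t ^ q) * ∑ j, a j 0 * t ^ q / (a j 0 + a j 1 * t ^ p + a j 2 * t ^ q)) := by
  constructor <;>
  · simp only [letterSum_three_top_eq_div d0 p q a _ ht]
    simp only [Fin.sum_univ_three, Matrix.cons_val_zero, Matrix.cons_val_one, Matrix.cons_val_two, Matrix.head_cons,
      Matrix.tail_cons, Nat.cast_add]
    field_simp
    ring

/-- ★ **Sign-free twin of ✓ `eulerNumeratorTop_roots_Icc_le_one_of_letterSumOne_pos`** (K = 3, TOP coupling, `0 < p < q`, EVERY
company — the lower-signed hypothesis `hls` is dropped): on a pole-free `[u,v] ⊂ (0,∞)` on which `B₁ = Σ_j a_{j1}x^q/g_j > 0`,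
`eulerNumerator d a 2` has AT MOST ONE zero (reduced moment `−p(q−p)·t^{p−q}·B₁(t) < 0`). [this file's theorem; val-idea-25 AB6-2] -/
theorem eulerNumeratorTop_roots_Icc_le_one_of_letterSumOne_pos_signfree {m : ℕ} (d0 p q : ℕ) (hp : 0 < p) (hpq : p < q)
    (a : Fin m → Fin 3 → ℝ) {u v : ℝ} (hu : 0 < u)
    (hg : ∀ x ∈ Set.Icc u v, ∀ j, a j 0 + a j 1 * x ^ p + a j 2 * x ^ q ≠ 0)
    (hB : ∀ x ∈ Set.Icc u v, 0 < ∑ j, a j 1 * x ^ q / (a j 0 + a j 1 * x ^ p + a j 2 * x ^ q)) :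
    ((∑ j, (∑ l, C (a j l * (((![d0, d0 + p, d0 + q] : Fin 3 → ℕ) l : ℝ) - (![d0, d0 + p, d0 + q] : Fin 3 → ℕ) 2)) *
        X ^ ((![d0, d0 + p, d0 + q] : Fin 3 → ℕ) l)) *
      ∏ i ∈ Finset.univ.erase j, (∑ l, C (a i l) * X ^ ((![d0, d0 + p, d0 + q] : Fin 3 → ℕ) l)) : ℝ[X]).roots.toFinset.filter
        (fun t => u ≤ t ∧ t ≤ v)).card ≤ 1 := by
  have hf : ∀ t ∈ Set.Icc u v, ∀ j, (∑ l, C (a j l) * X ^ ((![d0, d0 + p, d0 + q] : Fin 3 → ℕ) l) : ℝ[X]).eval t ≠ 0 :=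
    fun t ht j => by
      rw [eval_row_three]
      exact mul_ne_zero (pow_ne_zero _ (hu.trans_le ht.1).ne') (hg t ht j)
  refine eulerNumerator_roots_Icc_le_one_of_reducedMoment_neg _ a 2 hu hf fun t ht _ => ⟨-(q : ℝ), ?_⟩
  have ht0 : 0 < t := hu.trans_le ht.1
  refine ((reducedMoment_three_top d0 p q a ht0.ne').1).trans_lt ?_
  have h1 : 0 < (p : ℝ) * ((q : ℝ) - p) * t ^ p / t ^ q :=
    div_pos (mul_pos (mul_pos (by exact_mod_cast hp) (sub_pos.mpr (by exact_mod_cast hpq))) (pow_pos ht0 _)) (pow_pos ht0 _)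
  exact mul_neg_of_neg_of_pos (neg_lt_zero.mpr h1) (hB t ht)

/-- ★ **Sign-free twin of ✓ `eulerNumeratorTop_roots_Icc_le_one_of_letterSumZero_neg`** (K = 3, TOP coupling, `0 < p < q`, EVERY
company): on a pole-free `[u,v] ⊂ (0,∞)` on which `B₀ = Σ_j a_{j0}x^q/g_j < 0`, `eulerNumerator d a 2` has AT MOST ONE zero
(reduced moment `pq·t^{−q}·B₀(t) < 0`). [this file's theorem; val-idea-25 AB6-2] -/
theorem eulerNumeratorTop_roots_Icc_le_one_of_letterSumZero_neg_signfree {m : ℕ} (d0 p q : ℕ) (hp : 0 < p) (hpq : p < q)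
    (a : Fin m → Fin 3 → ℝ) {u v : ℝ} (hu : 0 < u)
    (hg : ∀ x ∈ Set.Icc u v, ∀ j, a j 0 + a j 1 * x ^ p + a j 2 * x ^ q ≠ 0)
    (hB : ∀ x ∈ Set.Icc u v, ∑ j, a j 0 * x ^ q / (a j 0 + a j 1 * x ^ p + a j 2 * x ^ q) < 0) :
    ((∑ j, (∑ l, C (a j l * (((![d0, d0 + p, d0 + q] : Fin 3 → ℕ) l : ℝ) - (![d0, d0 + p, d0 + q] : Fin 3 → ℕ) 2)) *
        X ^ ((![d0, d0 + p, d0 + q] : Fin 3 → ℕ) l)) *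
      ∏ i ∈ Finset.univ.erase j, (∑ l, C (a i l) * X ^ ((![d0, d0 + p, d0 + q] : Fin 3 → ℕ) l)) : ℝ[X]).roots.toFinset.filter
        (fun t => u ≤ t ∧ t ≤ v)).card ≤ 1 := by
  have hf : ∀ t ∈ Set.Icc u v, ∀ j, (∑ l, C (a j l) * X ^ ((![d0, d0 + p, d0 + q] : Fin 3 → ℕ) l) : ℝ[X]).eval t ≠ 0 :=
    fun t ht j => by
      rw [eval_row_three]
      exact mul_ne_zero (pow_ne_zero _ (hu.trans_le ht.1).ne') (hg t ht j)
  refine eulerNumerator_roots_Icc_le_one_of_reducedMoment_neg _ a 2 hu hf fun t ht _ => ⟨(p : ℝ) - q, ?_⟩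
  have ht0 : 0 < t := hu.trans_le ht.1
  refine ((reducedMoment_three_top d0 p q a ht0.ne').2).trans_lt ?_
  have h1 : 0 < (p : ℝ) * (q : ℝ) / t ^ q :=
    div_pos (mul_pos (by exact_mod_cast hp) (by exact_mod_cast (hp.trans hpq))) (pow_pos ht0 _)
  exact mul_neg_of_pos_of_neg h1 (hB t ht)

/-! ### §4 Every K, bottom coupling — sign-free twins of ✓ `…ABWindowK` -/

/-- One letter sum through the stripped rows `G_j(t) = Σ_l a_{jl} t^{d_l − d_0}` (every K, `d_0` minimal):
`Σ_j a_{jl}/f_j(t) = (t^{d_0})⁻¹ · Σ_j a_{jl}/G_j(t)`. [folklore] -/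
theorem letterSumK_eq_inv_mul {m K : ℕ} (d : Fin K → ℕ) (i₀ : Fin K) (hd : ∀ l, d i₀ ≤ d l) (a : Fin m → Fin K → ℝ)
    (l : Fin K) (t : ℝ) :
    ∑ j, a j l / (∑ l', C (a j l') * X ^ (d l') : ℝ[X]).eval t
      = (t ^ (d i₀))⁻¹ * ∑ j, a j l / ∑ l', a j l' * t ^ (d l' - d i₀) := by
  rw [Finset.mul_sum]
  refine Finset.sum_congr rfl fun j _ => ?_
  rw [eval_factor_eq_pow_mul_stripped d i₀ hd (a j) t, mul_comm (t ^ (d i₀)), ← div_div, div_eq_mul_inv, mul_comm]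

/-- ★ **Sign-free twin of ✓ `eulerNumeratorK_roots_Icc_le_one_of_letterSums_pos`** (every `K ≥ 3`, strictly increasing support,
bottom coupling, EVERY company — `hus` dropped): on a pole-free `[u,v] ⊂ (0,∞)` on which every middle stripped letter sum
`A_l = Σ_j a_{jl}/G_j`, `1 ≤ l ≤ K−2`, is POSITIVE, the c-free Euler numerator has AT MOST ONE zero (reduced moment with `κ = e_{K−1}`:
`Σ_{0<l<K−1} e_l(e_l − e_{K−1})·t^{d_l}·A_l(t)/t^{d_0} < 0`, strict at the letter `l = 1` — crit-1 g4 #150). [this file's theorem] -/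
theorem eulerNumeratorK_roots_Icc_le_one_of_letterSums_pos_signfree {m K : ℕ} (hK : 3 ≤ K) (d : Fin K → ℕ) (hd : StrictMono d)
    (a : Fin m → Fin K → ℝ)
    {u v : ℝ} (hu : 0 < u) (hG : ∀ x ∈ Set.Icc u v, ∀ j, (∑ l', a j l' * x ^ (d l' - d ⟨0, by omega⟩)) ≠ 0)
    (hA : ∀ x ∈ Set.Icc u v, ∀ l : Fin K, 0 < (l : ℕ) → (l : ℕ) < K - 1 →
      0 < ∑ j, a j l / ∑ l', a j l' * x ^ (d l' - d ⟨0, by omega⟩)) :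
    ((∑ j, (∑ l, C (a j l * ((d l : ℝ) - d ⟨0, by omega⟩)) * X ^ (d l)) *
      ∏ i ∈ Finset.univ.erase j, (∑ l, C (a i l) * X ^ (d l)) : ℝ[X]).roots.toFinset.filter (fun t => u ≤ t ∧ t ≤ v)).card ≤ 1 := by
  have hle0 : ∀ l, d ⟨0, by omega⟩ ≤ d l := fun l =>
    hd.monotone (Fin.mk_le_mk.mpr (Nat.zero_le _) : (⟨0, by omega⟩ : Fin K) ≤ ⟨l, l.isLt⟩)
  have hf : ∀ t ∈ Set.Icc u v, ∀ j, (∑ l, C (a j l) * X ^ (d l) : ℝ[X]).eval t ≠ 0 := fun t ht j => by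
    rw [eval_factor_eq_pow_mul_stripped d ⟨0, by omega⟩ hle0 (a j) t]
    exact mul_ne_zero (pow_ne_zero _ (hu.trans_le ht.1).ne') (hG t ht j)
  refine eulerNumerator_roots_Icc_le_one_of_reducedMoment_neg d a ⟨0, by omega⟩ hu hf fun t ht _ =>
    ⟨(d ⟨K - 1, by omega⟩ : ℝ) - d ⟨0, by omega⟩, ?_⟩
  have ht0 : 0 < t := hu.trans_le ht.1
  simp only [letterSumK_eq_inv_mul d ⟨0, by omega⟩ hle0 a _ t]
  -- every term is `≤ 0`, the middle terms are `< 0`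
  have hmid : ∀ l : Fin K, 0 < (l : ℕ) → (l : ℕ) < K - 1 →
      ((d l : ℝ) - d ⟨0, by omega⟩) * (((d l : ℝ) - d ⟨0, by omega⟩) - ((d ⟨K - 1, by omega⟩ : ℝ) - d ⟨0, by omega⟩)) * t ^ (d l)
        * ((t ^ (d ⟨0, by omega⟩))⁻¹ * ∑ j, a j l / ∑ l', a j l' * t ^ (d l' - d ⟨0, by omega⟩)) < 0 := by
    intro l hl hl'
    have h0l : d ⟨0, by omega⟩ < d l := hd (Fin.mk_lt_mk.mpr hl : (⟨0, by omega⟩ : Fin K) < ⟨l, l.isLt⟩)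
    have hlt : d l < d ⟨K - 1, by omega⟩ := hd (Fin.mk_lt_mk.mpr hl' : (⟨l, l.isLt⟩ : Fin K) < ⟨K - 1, by omega⟩)
    have he1 : 0 < (d l : ℝ) - d ⟨0, by omega⟩ := sub_pos.mpr (by exact_mod_cast h0l)
    have he2 : ((d l : ℝ) - d ⟨0, by omega⟩) - ((d ⟨K - 1, by omega⟩ : ℝ) - d ⟨0, by omega⟩) < 0 := by
      have : (d l : ℝ) < d ⟨K - 1, by omega⟩ := by exact_mod_cast hlt
      linarith
    have hS : 0 < (t ^ (d ⟨0, by omega⟩))⁻¹ * ∑ j, a j l / ∑ l', a j l' * t ^ (d l' - d ⟨0, by omega⟩) :=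
      mul_pos (inv_pos.mpr (pow_pos ht0 _)) (hA t ht l hl hl')
    exact mul_neg_of_neg_of_pos (mul_neg_of_neg_of_pos (mul_neg_of_pos_of_neg he1 he2) (pow_pos ht0 _)) hS
  have hall : ∀ l : Fin K,
      ((d l : ℝ) - d ⟨0, by omega⟩) * (((d l : ℝ) - d ⟨0, by omega⟩) - ((d ⟨K - 1, by omega⟩ : ℝ) - d ⟨0, by omega⟩)) * t ^ (d l)
        * ((t ^ (d ⟨0, by omega⟩))⁻¹ * ∑ j, a j l / ∑ l', a j l' * t ^ (d l' - d ⟨0, by omega⟩)) ≤ 0 := by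
    intro l
    by_cases hl : (l : ℕ) = 0
    · have : l = ⟨0, by omega⟩ := Fin.ext hl
      rw [this, sub_self, zero_mul, zero_mul, zero_mul]
    by_cases hl' : (l : ℕ) = K - 1
    · have : l = ⟨K - 1, by omega⟩ := Fin.ext hl'
      rw [this, sub_self, mul_zero, zero_mul, zero_mul]
    · exact (hmid l (Nat.pos_of_ne_zero hl) (by have := l.isLt; omega)).le
  calc _ < ∑ _l : Fin K, (0 : ℝ) :=
        Finset.sum_lt_sum (fun l _ => hall l) ⟨⟨1, by omega⟩, Finset.mem_univ _, hmid _ (by simp) (by simp; omega)⟩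
    _ = 0 := Finset.sum_const_zero

/-- ★ **Sign-free twin of ✓ `eulerNumeratorK_roots_Icc_le_one_of_letterSums_neg`** (every `K ≥ 3`, strictly increasing support,
bottom coupling, EVERY company — `hus` dropped): on a pole-free `[u,v] ⊂ (0,∞)` on which every stripped letter sum `A_l`, `l ≥ 2`, is
NEGATIVE, the c-free Euler numerator has AT MOST ONE zero (reduced moment with `κ = e_1`:
`Σ_{l≥2} e_l(e_l − e_1)·t^{d_l}·A_l(t)/t^{d_0} < 0`, strict at `l = 2`). [this file's theorem] -/
theorem eulerNumeratorK_roots_Icc_le_one_of_letterSums_neg_signfree {m K : ℕ} (hK : 3 ≤ K) (d : Fin K → ℕ) (hd : StrictMono d)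
    (a : Fin m → Fin K → ℝ)
    {u v : ℝ} (hu : 0 < u) (hG : ∀ x ∈ Set.Icc u v, ∀ j, (∑ l', a j l' * x ^ (d l' - d ⟨0, by omega⟩)) ≠ 0)
    (hA : ∀ x ∈ Set.Icc u v, ∀ l : Fin K, 2 ≤ (l : ℕ) → ∑ j, a j l / ∑ l', a j l' * x ^ (d l' - d ⟨0, by omega⟩) < 0) :
    ((∑ j, (∑ l, C (a j l * ((d l : ℝ) - d ⟨0, by omega⟩)) * X ^ (d l)) *
      ∏ i ∈ Finset.univ.erase j, (∑ l, C (a i l) * X ^ (d l)) : ℝ[X]).roots.toFinset.filter (fun t => u ≤ t ∧ t ≤ v)).card ≤ 1 := by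
  have hle0 : ∀ l, d ⟨0, by omega⟩ ≤ d l := fun l =>
    hd.monotone (Fin.mk_le_mk.mpr (Nat.zero_le _) : (⟨0, by omega⟩ : Fin K) ≤ ⟨l, l.isLt⟩)
  have hf : ∀ t ∈ Set.Icc u v, ∀ j, (∑ l, C (a j l) * X ^ (d l) : ℝ[X]).eval t ≠ 0 := fun t ht j => by
    rw [eval_factor_eq_pow_mul_stripped d ⟨0, by omega⟩ hle0 (a j) t]
    exact mul_ne_zero (pow_ne_zero _ (hu.trans_le ht.1).ne') (hG t ht j)
  refine eulerNumerator_roots_Icc_le_one_of_reducedMoment_neg d a ⟨0, by omega⟩ hu hf fun t ht _ =>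
    ⟨(d ⟨1, by omega⟩ : ℝ) - d ⟨0, by omega⟩, ?_⟩
  have ht0 : 0 < t := hu.trans_le ht.1
  simp only [letterSumK_eq_inv_mul d ⟨0, by omega⟩ hle0 a _ t]
  have hbig : ∀ l : Fin K, 2 ≤ (l : ℕ) →
      ((d l : ℝ) - d ⟨0, by omega⟩) * (((d l : ℝ) - d ⟨0, by omega⟩) - ((d ⟨1, by omega⟩ : ℝ) - d ⟨0, by omega⟩)) * t ^ (d l)
        * ((t ^ (d ⟨0, by omega⟩))⁻¹ * ∑ j, a j l / ∑ l', a j l' * t ^ (d l' - d ⟨0, by omega⟩)) < 0 := by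
    intro l hl
    have h0l : d ⟨0, by omega⟩ < d l := hd (Fin.mk_lt_mk.mpr (by omega) : (⟨0, by omega⟩ : Fin K) < ⟨l, l.isLt⟩)
    have h1l : d ⟨1, by omega⟩ < d l := hd (Fin.mk_lt_mk.mpr (by omega) : (⟨1, by omega⟩ : Fin K) < ⟨l, l.isLt⟩)
    have he1 : 0 < (d l : ℝ) - d ⟨0, by omega⟩ := sub_pos.mpr (by exact_mod_cast h0l)
    have he2 : 0 < ((d l : ℝ) - d ⟨0, by omega⟩) - ((d ⟨1, by omega⟩ : ℝ) - d ⟨0, by omega⟩) := by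
      have : (d ⟨1, by omega⟩ : ℝ) < d l := by exact_mod_cast h1l
      linarith
    have hS : (t ^ (d ⟨0, by omega⟩))⁻¹ * ∑ j, a j l / ∑ l', a j l' * t ^ (d l' - d ⟨0, by omega⟩) < 0 :=
      mul_neg_of_pos_of_neg (inv_pos.mpr (pow_pos ht0 _)) (hA t ht l hl)
    exact mul_neg_of_pos_of_neg (mul_pos (mul_pos he1 he2) (pow_pos ht0 _)) hS
  have hall : ∀ l : Fin K,
      ((d l : ℝ) - d ⟨0, by omega⟩) * (((d l : ℝ) - d ⟨0, by omega⟩) - ((d ⟨1, by omega⟩ : ℝ) - d ⟨0, by omega⟩)) * t ^ (d l)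
        * ((t ^ (d ⟨0, by omega⟩))⁻¹ * ∑ j, a j l / ∑ l', a j l' * t ^ (d l' - d ⟨0, by omega⟩)) ≤ 0 := by
    intro l
    by_cases hl : (l : ℕ) = 0
    · have : l = ⟨0, by omega⟩ := Fin.ext hl
      rw [this, sub_self, zero_mul, zero_mul, zero_mul]
    by_cases hl' : (l : ℕ) = 1
    · have : l = ⟨1, by omega⟩ := Fin.ext hl'
      rw [this, sub_self, mul_zero, zero_mul, zero_mul]
    · exact (hbig l (by omega)).le
  calc _ < ∑ _l : Fin K, (0 : ℝ) :=
        Finset.sum_lt_sum (fun l _ => hall l) ⟨⟨2, by omega⟩, Finset.mem_univ _, hbig _ (by simp)⟩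
    _ = 0 := Finset.sum_const_zero

end ProductPlusOne

end Summit.ValiantsHypothesis.ValiantsHypothesis.Theorems.LacunarySymmetroidMatrixDescartes
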